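import Mathlib
import Literature.Analysis.FluidPDE.VectorCalculus
import Summits.NavierStokesRegularity.NavierStokesRegularity.Theorems.ThreadingFluxErtelTowerJetRigidity
import Summits.NavierStokesRegularity.NavierStokesRegularity.Theorems.ThreadingFluxErtelTowerLinearFlowDichotomy
import HarnessLib

/-!
# Crux `PoloidalLiouville` (stmt-NavierStokesRegularity-1222, W1), crux idea «radial-jerk-tower» (ns-idea-15 g7):
# THE CUBIC GERM OF THE DISCRIMINANT AT A STAGNATION CENTRE (smooth steady drift)

Support file (`--supports stmt-NavierStokesRegularity-1222`, helper).  Experiment cell `ns-wall-extremal`, width hand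
ns-wall-eng-5 g9, item (ε) E6a (first half of the «analytic nonlinear upgrade of (ε) at stagnation points» named by g8's
handoff, `HOME/ARM-B/shadow-eng5g8/README.md`, SUCCESSOR ITEM 1).  0 kit.  Theorem-only; nothing of the sketch
`Cruxes/PoloidalLiouville/ErtelTowerSketch.lean` is restated or closed.

E5 (`…ErtelTowerJetRigidity`, `inviscidJetRigidity_nonStagnation`) decided the inviscid shadow about a centre `x₀` with
`v × (A v + 2A† v) ≠ 0`, `v = u(x₀)`, `A = Du(x₀)` — a condition that is VOID at a stagnation point (`v = 0`), where the
discriminant `D(x) = ⟪x − x₀, ∇θ₁(x) × ∇θ₂(x)⟫` of `inviscidKinematicRigidity` vanishes to third order.  This file reads off its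
CUBIC germ from the 1-jet, for a SMOOTH steady drift `u` on an open `U ∋ x₀` with `u x₀ = 0`:

* `tendsto_slope_ray` — `t⁻¹ f(x₀ + t z) → Df(x₀) z` for `f x₀ = 0`;
* ★ `tendsto_slope_gradient_thetaOne` — `t⁻¹ ∇θ₁(x₀ + t z) → A† z + A z` (`∇θ₁ = (Du)†(x − x₀) + u`, E5);
* `gradient_thetaTwo_steady` — `∇θ₂ = (DG)†(x − x₀) + G + 2(Du)†u` on `U`, `G = Du·u` (E5's centre formula at every point);
  ★ `tendsto_slope_gradient_thetaTwo` — `t⁻¹ ∇θ₂(x₀ + t z) → A†A† z + A A z + 2A†A z` (`= (A†(A + A†) + (A + A†)A) z`);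
* ★ `tendsto_slope_disc` — `t⁻³ D(x₀ + t z) → ⟪z, (A† z + A z) × (A†A† z + AA z + 2A†A z)⟫ = D_A(z)`, the cubic of the LINEAR
  drift `A(x − x₀)` (`linDisc_eq`, E1); `linDisc_apply_eq_zero_of_disc_eventuallyEq_zero` — `D` flat at `x₀` ⇒ `D_A ≡ 0`;
* ★★ `disc_not_eventuallyEq_zero_of_stagnation` — **if `A = Du(x₀)` commutes with NO rotation generator `z ↦ w × z` (`w ≠ 0`),
  the discriminant is NOT identically zero on any neighbourhood of the stagnation centre** (E3 `linDisc_ne_zero_or_axisymmetric`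
  BY NAME: `D_A ≢ 0`).  First derivatives and continuity only — no Taylor expansion of the tower is needed.

The analytic consequences (identity theorem ⇒ `{D ≠ 0}` dense ⇒ `inviscidKinematicRigidity`) are in
`…ErtelTowerStagnationJetRigidity` (E6b).

HONEST FRAME: pointwise/germ statements about the INVISCID shadow (frozen-field equation) in a prescribed smooth steady drift;
information-grade helper under ⟨1222⟩; says nothing about NS; `PoloidalLiouville` (1222) / `UnthreadedRigidity` (27585) OPEN;
NS regularity NOT proved.
-/

-- the summit and its single problem share the name (D-0017 nested layout)
set_option linter.dupNamespace false

noncomputable section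

namespace Summit.NavierStokesRegularity.NavierStokesRegularity.Theorems.PoloidalLiouville.ErtelTower

open Set Function Filter Metric Topology
open scoped Topology RealInnerProductSpace InnerProductSpace ContDiff
open Literature.Analysis.FluidPDE
open Summit.NavierStokesRegularity.NavierStokesRegularity.Theorems.PoloidalLiouville.HorizonTower (E3)

/-! ### Slopes along rays through a zero -/

section Slopes

variable {F : Type*} [NormedAddCommGroup F] [NormedSpace ℝ F]

/-- The ray `t ↦ x₀ + t • z` tends to `x₀` as `t → 0`. -/
theorem tendsto_ray (x₀ z : E3) : Tendsto (fun t : ℝ => x₀ + t • z) (𝓝 0) (𝓝 x₀) := by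
  have h : Continuous (fun t : ℝ => x₀ + t • z) := by fun_prop
  simpa using h.tendsto 0

/-- **Slope of a map along a ray through a zero.**  If `f` is differentiable at `x₀` and `f x₀ = 0`, then
`t⁻¹ • f (x₀ + t z) → Df(x₀) z` as `t → 0`, `t ≠ 0`. -/
theorem tendsto_slope_ray {f : E3 → F} {x₀ : E3} (hf : DifferentiableAt ℝ f x₀) (h0 : f x₀ = 0) (z : E3) :
    Tendsto (fun t : ℝ => t⁻¹ • f (x₀ + t • z)) (𝓝[≠] 0) (𝓝 (fderiv ℝ f x₀ z)) := by
  have hline : HasDerivAt (fun t : ℝ => x₀ + t • z) z 0 := by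
    simpa using ((hasDerivAt_id (0 : ℝ)).smul_const z).const_add x₀
  have hcomp : HasDerivAt (fun t : ℝ => f (x₀ + t • z)) (fderiv ℝ f x₀ z) 0 :=
    hf.hasFDerivAt.comp_hasDerivAt_of_eq 0 hline (by simp)
  refine hcomp.tendsto_slope_zero.congr fun t => ?_
  simp [h0]

end Slopes

/-! ### The slopes of the first two tower gradients at a stagnation centre -/

section TowerSlopes

variable {u : E3 → E3} {U : Set E3} {x₀ : E3}

/-- The ray `x₀ + t z` stays inside the open `U ∋ x₀` for small `t ≠ 0`. -/
theorem eventually_ray_mem (hU : IsOpen U) (hx₀ : x₀ ∈ U) (z : E3) :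
    ∀ᶠ t : ℝ in 𝓝[≠] 0, x₀ + t • z ∈ U :=
  nhdsWithin_le_nhds (tendsto_ray x₀ z (hU.mem_nhds hx₀))

/-- `y ↦ (Du y)† w` is continuous at `x₀` for a drift smooth on an open `U ∋ x₀`. -/
theorem continuousAt_adjoint_fderiv_apply (hU : IsOpen U) (hu : ContDiffOn ℝ (⊤ : ℕ∞) u U) (hx₀ : x₀ ∈ U) (w : E3) :
    ContinuousAt (fun y : E3 => ContinuousLinearMap.adjoint (fderiv ℝ u y) w) x₀ := by
  have hDu : ContinuousAt (fderiv ℝ u) x₀ :=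
    (hu.continuousOn_fderiv_of_isOpen hU (by simp)).continuousAt (hU.mem_nhds hx₀)
  have hadj : ContinuousAt (fun y : E3 => ContinuousLinearMap.adjoint (fderiv ℝ u y)) x₀ :=
    (ContinuousLinearMap.adjoint : (E3 →L[ℝ] E3) ≃ₗᵢ⋆[ℝ] (E3 →L[ℝ] E3)).continuous.continuousAt.comp hDu
  exact hadj.clm_apply continuousAt_const

/-- ★ **Slope of `∇θ₁` at a stagnation centre**: `t⁻¹ ∇θ₁(x₀ + t z) → A† z + A z`, `A = Du(x₀)`, when `u x₀ = 0`
(from `∇θ₁(x) = (Du x)†(x − x₀) + u x`: the first term is exactly `t (Du(x₀+tz))† z`, the second has slope `A z`). -/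
theorem tendsto_slope_gradient_thetaOne (hU : IsOpen U) (hu : ContDiffOn ℝ (⊤ : ℕ∞) u U) (hx₀ : x₀ ∈ U)
    (hstag : u x₀ = 0) (z : E3) :
    Tendsto (fun t : ℝ => t⁻¹ • gradient (radialJerk (fun _ : ℝ => u) x₀ 1 0) (x₀ + t • z)) (𝓝[≠] 0)
      (𝓝 (ContinuousLinearMap.adjoint (fderiv ℝ u x₀) z + fderiv ℝ u x₀ z)) := by
  have hud : DifferentiableAt ℝ u x₀ := (hu.differentiableOn (by simp)).differentiableAt (hU.mem_nhds hx₀)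
  -- the formula along the ray
  have hformula : ∀ᶠ t : ℝ in 𝓝[≠] 0,
      ContinuousLinearMap.adjoint (fderiv ℝ u (x₀ + t • z)) z + t⁻¹ • u (x₀ + t • z)
        = t⁻¹ • gradient (radialJerk (fun _ : ℝ => u) x₀ 1 0) (x₀ + t • z) := by
    filter_upwards [eventually_ray_mem hU hx₀ z, self_mem_nhdsWithin] with t ht ht0
    have ht0' : t ≠ 0 := ht0
    have hudt : DifferentiableAt ℝ u (x₀ + t • z) :=
      (hu.differentiableOn (by simp)).differentiableAt (hU.mem_nhds ht)
    rw [gradient_thetaOne_steady hudt, add_sub_cancel_left, map_smul, smul_add, inv_smul_smul₀ ht0']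
  -- the two limits
  have h1 : Tendsto (fun t : ℝ => ContinuousLinearMap.adjoint (fderiv ℝ u (x₀ + t • z)) z) (𝓝[≠] 0)
      (𝓝 (ContinuousLinearMap.adjoint (fderiv ℝ u x₀) z)) := by
    have h := (continuousAt_adjoint_fderiv_apply hU hu hx₀ z).tendsto.comp (tendsto_ray x₀ z)
    exact h.mono_left nhdsWithin_le_nhds
  have h2 := tendsto_slope_ray hud hstag z
  exact (h1.add h2).congr' hformula


/-- `∇θ₂(y) = (DG y)†(y − x₀) + G y + 2 (Du y)†(u y)` on `U`, with `G y = Du(y)(u y)` (the formula of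
`gradient_thetaTwo_centre`, at every point of `U`). -/
theorem gradient_thetaTwo_steady (hU : IsOpen U) (hu : ContDiffOn ℝ (⊤ : ℕ∞) u U) {y : E3} (hy : y ∈ U) :
    gradient (radialJerk (fun _ : ℝ => u) x₀ 2 0) y =
      ContinuousLinearMap.adjoint (fderiv ℝ (fun w => fderiv ℝ u w (u w)) y) (y - x₀) + fderiv ℝ u y (u y)
        + (2 : ℝ) • ContinuousLinearMap.adjoint (fderiv ℝ u y) (u y) := by
  have hud : DifferentiableAt ℝ u y := (hu.differentiableOn (by simp)).differentiableAt (hU.mem_nhds hy)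
  have hDu : ContDiffOn ℝ (⊤ : ℕ∞) (fderiv ℝ u) U := hu.fderiv_of_isOpen hU (by simp)
  have hG : DifferentiableAt ℝ (fun w => fderiv ℝ u w (u w)) y :=
    ((hDu.differentiableOn (by simp)).differentiableAt (hU.mem_nhds hy)).clm_apply hud
  have hev : radialJerk (fun _ : ℝ => u) x₀ 2 0 =ᶠ[𝓝 y]
      fun w => ⟪fderiv ℝ u w (u w), w - x₀⟫ + ⟪u w, u w⟫ := by
    filter_upwards [hU.mem_nhds hy] with w hw using thetaTwo_steady_eq hU hu hw
  rw [(gradient_congr_nhds hev).eq_of_nhds]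
  have hd1 : DifferentiableAt ℝ (fun w : E3 => ⟪fderiv ℝ u w (u w), w - x₀⟫) y :=
    hG.inner ℝ ((differentiableAt_id).sub_const x₀)
  have hd2 : DifferentiableAt ℝ (fun w : E3 => ⟪u w, u w⟫) y := hud.inner ℝ hud
  have hsum : (fun w : E3 => ⟪fderiv ℝ u w (u w), w - x₀⟫ + ⟪u w, u w⟫)
      = (fun w : E3 => ⟪fderiv ℝ u w (u w), w - x₀⟫) + fun w : E3 => ⟪u w, u w⟫ := rfl
  rw [hsum, gradient, fderiv_add hd1 hd2, map_add]
  change gradient (fun w : E3 => ⟪fderiv ℝ u w (u w), w - x₀⟫) y + gradient (fun w : E3 => ⟪u w, u w⟫) y = _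
  rw [gradient_inner_sub_centre hG, gradient_inner_self_drift hud]

/-- At a stagnation centre the derivative of `G y = Du(y)(u y)` is `A ∘ A`, `A = Du(x₀)` (the `D²u` term is
multiplied by `u x₀ = 0`). -/
theorem hasFDerivAt_fderiv_apply_drift_centre (hU : IsOpen U) (hu : ContDiffOn ℝ (⊤ : ℕ∞) u U) (hx₀ : x₀ ∈ U)
    (hstag : u x₀ = 0) :
    HasFDerivAt (fun w => fderiv ℝ u w (u w)) ((fderiv ℝ u x₀).comp (fderiv ℝ u x₀)) x₀ := by
  have hud : DifferentiableAt ℝ u x₀ := (hu.differentiableOn (by simp)).differentiableAt (hU.mem_nhds hx₀)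
  have hDu : ContDiffOn ℝ (⊤ : ℕ∞) (fderiv ℝ u) U := hu.fderiv_of_isOpen hU (by simp)
  have hDud : DifferentiableAt ℝ (fderiv ℝ u) x₀ :=
    (hDu.differentiableOn (by simp)).differentiableAt (hU.mem_nhds hx₀)
  have h := hDud.hasFDerivAt.clm_apply hud.hasFDerivAt
  rw [hstag, map_zero, add_zero] at h
  exact h

/-- `y ↦ (DG y)† w` is continuous at `x₀`, `G y = Du(y)(u y)`. -/
theorem continuousAt_adjoint_fderiv_apply_drift (hU : IsOpen U) (hu : ContDiffOn ℝ (⊤ : ℕ∞) u U) (hx₀ : x₀ ∈ U)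
    (w : E3) :
    ContinuousAt (fun y : E3 => ContinuousLinearMap.adjoint (fderiv ℝ (fun w => fderiv ℝ u w (u w)) y) w) x₀ := by
  have hG : ContDiffOn ℝ (⊤ : ℕ∞) (fun w => fderiv ℝ u w (u w)) U := (hu.fderiv_of_isOpen hU (by simp)).clm_apply hu
  exact continuousAt_adjoint_fderiv_apply hU hG hx₀ w

/-- ★ **Slope of `∇θ₂` at a stagnation centre**: `t⁻¹ ∇θ₂(x₀ + t z) → A†(A† z) + A(A z) + 2 A†(A z)`, `A = Du(x₀)`,
when `u x₀ = 0` (the three terms of `gradient_thetaTwo_steady` have slopes `(A∘A)† z`, `(A∘A) z`, `2A†(A z)`). -/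
theorem tendsto_slope_gradient_thetaTwo (hU : IsOpen U) (hu : ContDiffOn ℝ (⊤ : ℕ∞) u U) (hx₀ : x₀ ∈ U)
    (hstag : u x₀ = 0) (z : E3) :
    Tendsto (fun t : ℝ => t⁻¹ • gradient (radialJerk (fun _ : ℝ => u) x₀ 2 0) (x₀ + t • z)) (𝓝[≠] 0)
      (𝓝 (ContinuousLinearMap.adjoint (fderiv ℝ u x₀) (ContinuousLinearMap.adjoint (fderiv ℝ u x₀) z)
        + fderiv ℝ u x₀ (fderiv ℝ u x₀ z)
        + (2 : ℝ) • ContinuousLinearMap.adjoint (fderiv ℝ u x₀) (fderiv ℝ u x₀ z))) := by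
  have hud : DifferentiableAt ℝ u x₀ := (hu.differentiableOn (by simp)).differentiableAt (hU.mem_nhds hx₀)
  have hGd : HasFDerivAt (fun w => fderiv ℝ u w (u w)) ((fderiv ℝ u x₀).comp (fderiv ℝ u x₀)) x₀ :=
    hasFDerivAt_fderiv_apply_drift_centre hU hu hx₀ hstag
  have hG0 : (fun w => fderiv ℝ u w (u w)) x₀ = 0 := by simp [hstag]
  -- the formula along the ray
  have hformula : ∀ᶠ t : ℝ in 𝓝[≠] 0,
      ContinuousLinearMap.adjoint (fderiv ℝ (fun w => fderiv ℝ u w (u w)) (x₀ + t • z)) z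
          + t⁻¹ • (fun w => fderiv ℝ u w (u w)) (x₀ + t • z)
          + (2 : ℝ) • ContinuousLinearMap.adjoint (fderiv ℝ u (x₀ + t • z)) (t⁻¹ • u (x₀ + t • z))
        = t⁻¹ • gradient (radialJerk (fun _ : ℝ => u) x₀ 2 0) (x₀ + t • z) := by
    filter_upwards [eventually_ray_mem hU hx₀ z, self_mem_nhdsWithin] with t ht ht0
    have ht0' : t ≠ 0 := ht0
    rw [gradient_thetaTwo_steady hU hu ht, add_sub_cancel_left]
    simp only [map_smul, smul_add, smul_smul, inv_mul_cancel₀ ht0', one_smul, mul_comm t⁻¹ (2 : ℝ)]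
  -- the three limits
  have h1 : Tendsto (fun t : ℝ => ContinuousLinearMap.adjoint (fderiv ℝ (fun w => fderiv ℝ u w (u w)) (x₀ + t • z)) z)
      (𝓝[≠] 0) (𝓝 (ContinuousLinearMap.adjoint (fderiv ℝ u x₀) (ContinuousLinearMap.adjoint (fderiv ℝ u x₀) z))) := by
    have h := (continuousAt_adjoint_fderiv_apply_drift hU hu hx₀ z).tendsto.comp (tendsto_ray x₀ z)
    rw [hGd.fderiv, ContinuousLinearMap.adjoint_comp] at h
    exact h.mono_left nhdsWithin_le_nhds
  have h2 : Tendsto (fun t : ℝ => t⁻¹ • (fun w => fderiv ℝ u w (u w)) (x₀ + t • z)) (𝓝[≠] 0)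
      (𝓝 (fderiv ℝ u x₀ (fderiv ℝ u x₀ z))) := by
    have h := tendsto_slope_ray hGd.differentiableAt hG0 z
    rw [hGd.fderiv] at h
    exact h
  have h3 : Tendsto (fun t : ℝ => (2 : ℝ) • ContinuousLinearMap.adjoint (fderiv ℝ u (x₀ + t • z)) (t⁻¹ • u (x₀ + t • z)))
      (𝓝[≠] 0) (𝓝 ((2 : ℝ) • ContinuousLinearMap.adjoint (fderiv ℝ u x₀) (fderiv ℝ u x₀ z))) := by
    have hL : Tendsto (fun t : ℝ => ContinuousLinearMap.adjoint (fderiv ℝ u (x₀ + t • z))) (𝓝[≠] 0)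
        (𝓝 (ContinuousLinearMap.adjoint (fderiv ℝ u x₀))) := by
      have hDu : ContinuousAt (fderiv ℝ u) x₀ :=
        (hu.continuousOn_fderiv_of_isOpen hU (by simp)).continuousAt (hU.mem_nhds hx₀)
      have hadj : ContinuousAt (fun y : E3 => ContinuousLinearMap.adjoint (fderiv ℝ u y)) x₀ :=
        (ContinuousLinearMap.adjoint : (E3 →L[ℝ] E3) ≃ₗᵢ⋆[ℝ] (E3 →L[ℝ] E3)).continuous.continuousAt.comp hDu
      exact (hadj.tendsto.comp (tendsto_ray x₀ z)).mono_left nhdsWithin_le_nhds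
    have hv := tendsto_slope_ray hud hstag z
    have happ := (isBoundedBilinearMap_apply (𝕜 := ℝ) (E := E3) (F := E3)).continuous.tendsto
      (ContinuousLinearMap.adjoint (fderiv ℝ u x₀), fderiv ℝ u x₀ z)
    exact ((happ.comp (hL.prodMk_nhds hv)).const_smul (2 : ℝ))
  exact ((h1.add h2).add h3).congr' hformula


/-- ★ **Slope of the discriminant at a stagnation centre.**  With `D(x) = ⟪x − x₀, ∇θ₁(x) × ∇θ₂(x)⟫` (the discriminant of
`inviscidKinematicRigidity`) and `u x₀ = 0`:  `t⁻¹ ^ 3 · D(x₀ + t z) → ⟪z, (A† z + A z) × (A†A† z + A A z + 2A†A z)⟫` — the value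
at `z` of the cubic `D_A` of the linear drift `A(x − x₀)` (`linDisc_eq`, E1), in the normal form of `tendsto_slope_gradient_thetaTwo`. -/
theorem tendsto_slope_disc (hU : IsOpen U) (hu : ContDiffOn ℝ (⊤ : ℕ∞) u U) (hx₀ : x₀ ∈ U) (hstag : u x₀ = 0) (z : E3) :
    Tendsto (fun t : ℝ => t⁻¹ ^ 3 * ⟪x₀ + t • z - x₀,
        cross (gradient (radialJerk (fun _ : ℝ => u) x₀ 1 0) (x₀ + t • z))
          (gradient (radialJerk (fun _ : ℝ => u) x₀ 2 0) (x₀ + t • z))⟫) (𝓝[≠] 0)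
      (𝓝 ⟪z, cross (ContinuousLinearMap.adjoint (fderiv ℝ u x₀) z + fderiv ℝ u x₀ z)
        (ContinuousLinearMap.adjoint (fderiv ℝ u x₀) (ContinuousLinearMap.adjoint (fderiv ℝ u x₀) z)
          + fderiv ℝ u x₀ (fderiv ℝ u x₀ z)
          + (2 : ℝ) • ContinuousLinearMap.adjoint (fderiv ℝ u x₀) (fderiv ℝ u x₀ z))⟫) := by
  have h1 := tendsto_slope_gradient_thetaOne hU hu hx₀ hstag z
  have h2 := tendsto_slope_gradient_thetaTwo hU hu hx₀ hstag z
  have hcross := ((crossCLM.continuous₂.tendsto _).comp (h1.prodMk_nhds h2))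
  have hlim := Filter.Tendsto.inner (𝕜 := ℝ) (tendsto_const_nhds : Tendsto (fun _ : ℝ => z) (𝓝[≠] (0 : ℝ)) (𝓝 z)) hcross
  simp only [Function.comp_def, Function.uncurry_apply_pair, crossCLM_apply] at hlim
  refine hlim.congr' ?_
  filter_upwards [self_mem_nhdsWithin] with t ht0
  have ht0' : t ≠ 0 := ht0
  rw [add_sub_cancel_left, real_inner_smul_left]
  simp only [← crossCLM_apply, map_smul, smul_apply]
  rw [real_inner_smul_right, real_inner_smul_right, pow_succ, mul_assoc, inv_mul_cancel_left₀ ht0', sq, mul_assoc]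

/-- If the discriminant vanishes near a stagnation centre, the cubic `D_A` of the 1-jet `A = Du(x₀)` vanishes identically
(in the normal form of `linDisc_ne_zero_or_axisymmetric`, E3). -/
theorem linDisc_apply_eq_zero_of_disc_eventuallyEq_zero (hU : IsOpen U) (hu : ContDiffOn ℝ (⊤ : ℕ∞) u U) (hx₀ : x₀ ∈ U)
    (hstag : u x₀ = 0)
    (hflat : (fun x : E3 => ⟪x - x₀, cross (gradient (radialJerk (fun _ : ℝ => u) x₀ 1 0) x)
        (gradient (radialJerk (fun _ : ℝ => u) x₀ 2 0) x)⟫) =ᶠ[𝓝 x₀] fun _ => 0) (z : E3) :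
    ⟪z, cross ((fderiv ℝ u x₀ + ContinuousLinearMap.adjoint (fderiv ℝ u x₀)) z)
      ((ContinuousLinearMap.adjoint (fderiv ℝ u x₀)) ((fderiv ℝ u x₀ + ContinuousLinearMap.adjoint (fderiv ℝ u x₀)) z)
        + (fderiv ℝ u x₀ + ContinuousLinearMap.adjoint (fderiv ℝ u x₀)) (fderiv ℝ u x₀ z))⟫ = 0 := by
  have hlim := tendsto_slope_disc hU hu hx₀ hstag z
  -- along the ray the slope function is eventually `0`
  have hzero : ∀ᶠ t : ℝ in 𝓝[≠] 0, (0 : ℝ) = t⁻¹ ^ 3 * ⟪x₀ + t • z - x₀,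
      cross (gradient (radialJerk (fun _ : ℝ => u) x₀ 1 0) (x₀ + t • z))
        (gradient (radialJerk (fun _ : ℝ => u) x₀ 2 0) (x₀ + t • z))⟫ := by
    have h : ∀ᶠ t : ℝ in 𝓝 (0 : ℝ), ⟪x₀ + t • z - x₀,
        cross (gradient (radialJerk (fun _ : ℝ => u) x₀ 1 0) (x₀ + t • z))
          (gradient (radialJerk (fun _ : ℝ => u) x₀ 2 0) (x₀ + t • z))⟫ = 0 := (tendsto_ray x₀ z).eventually hflat
    filter_upwards [mem_nhdsWithin_of_mem_nhds h] with t ht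
    rw [ht, mul_zero]
  have hlim0 : Tendsto (fun t : ℝ => t⁻¹ ^ 3 * ⟪x₀ + t • z - x₀,
      cross (gradient (radialJerk (fun _ : ℝ => u) x₀ 1 0) (x₀ + t • z))
        (gradient (radialJerk (fun _ : ℝ => u) x₀ 2 0) (x₀ + t • z))⟫) (𝓝[≠] 0) (𝓝 0) :=
    tendsto_const_nhds.congr' hzero
  have heq := tendsto_nhds_unique hlim hlim0
  -- the two normal forms of the cubic agree
  rw [← heq]
  simp only [add_apply, map_add, two_smul]
  abel_nf

/-- ★★ **NON-FLATNESS OF THE DISCRIMINANT AT A NON-AXISYMMETRIC STAGNATION CENTRE (smooth drift).**  Let `u` be smooth on an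
open `U ∋ x₀` with `u x₀ = 0`, and suppose the velocity gradient `A = Du(x₀)` commutes with NO rotation generator `z ↦ w × z`
(`w ≠ 0`).  Then the discriminant `D(x) = ⟪x − x₀, ∇θ₁(x) × ∇θ₂(x)⟫` of `inviscidKinematicRigidity` is NOT identically zero on
any neighbourhood of `x₀` (E3 `linDisc_ne_zero_or_axisymmetric`: `D_A ≢ 0`, and `D = D_A + o(|x − x₀|³)` along rays). -/
theorem disc_not_eventuallyEq_zero_of_stagnation (hU : IsOpen U) (hu : ContDiffOn ℝ (⊤ : ℕ∞) u U) (hx₀ : x₀ ∈ U)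
    (hstag : u x₀ = 0)
    (hA : ¬ ∃ w : E3, w ≠ 0 ∧ ∀ z : E3, fderiv ℝ u x₀ (cross w z) = cross w (fderiv ℝ u x₀ z)) :
    ¬ ((fun x : E3 => ⟪x - x₀, cross (gradient (radialJerk (fun _ : ℝ => u) x₀ 1 0) x)
        (gradient (radialJerk (fun _ : ℝ => u) x₀ 2 0) x)⟫) =ᶠ[𝓝 x₀] fun _ => 0) := by
  intro hflat
  rcases linDisc_ne_zero_or_axisymmetric (fderiv ℝ u x₀) with ⟨v, hv⟩ | hax
  · exact hv (linDisc_apply_eq_zero_of_disc_eventuallyEq_zero hU hu hx₀ hstag hflat v)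
  · exact hA hax

end TowerSlopes

end Summit.NavierStokesRegularity.NavierStokesRegularity.Theorems.PoloidalLiouville.ErtelTower

end
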